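import Summits.CriticalPhenomena.PercolationContinuityZ3.Theorems.PercNearOneGluingNoHeavyQuantTenBlobsD
import HarnessLib

/-!
# QUANT lane R8, T-DEC: TEN EQUAL BLOBS WITH A COMMON GATE ARE HEAVY AT THAT GATE FOR EVERY `g ∈ (0,1)` — the 8 band cells of
# `2/10 < g < 1/2` by the uniform-spreading certificate (prim-quant-census-2 gen 83, generated by g82's code/gen_equal.py as patched in g83 code/gen_equal10.py (three-low template, strict cell at 2/5, point cell))

builds on p205010 (kernel theorem, internal audit signed; external expert review pending)

Support file (`--supports stmt-CriticalPhenomena-4575`), QUANT lane census seat prim-quant-census-2 (gen 83); memo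
`run/shared/lean/prim/quant/prim-quant-census-2-g83/HOEFFDING-G83.md` §6 (method: census-2 g82, REFLECTION-G82.md §3).  Theorems only, standard axioms, no sorries, no definitions.

Conjecture BLOB-AFL for 10 EQUAL blobs `(k,g)`: `blobLaw (replicate 10 (k,g))` heavy at floor `g`, target `10·k·g`.  Flanks: `g ≤ 2/10` (zero-only-low,
`heavy_blobLaw_of_mean_le_two`) and `g ≥ 1/2` (reflection, `heavy_blobLaw_replicate_of_half_le`); each band cell (cut where a low atom's admissible
set or its cheapest gate changes) is ONE univariate inequality `load ≤ 1`, cleared to `g^a(1−g)^m·R(g) ≥ 0` with `R > 0` on the cell by the shift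
`g = g₀ + t` and monomial bounds (same flow pattern as `…QuantFiveBlobs`, `…QuantSixBlobs`).
* FIVE FILES `…QuantTenBlobsA…E` (this is part E): per cell `tenBlobs_R<i>_pos`, `tenBlobs_load<i>_le_one`, `heavy_blobLaw_replicate_ten_cell<i>`; the POINT
  `heavy_blobLaw_replicate_ten_point` (`g = 2/5`: the low atom `2k` appears only beyond, the admissible set of the low `k` changes exactly there);
  **`heavy_blobLaw_replicate_ten`** (EVERY `0 < g < 1`), `decAtT_blobLaw_replicate_ten` in part E.  With `…QuantGatesWidthTen`: BLOB-AFL for every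
  gate vector of width ≤ 10.

HONEST STATUS.  `SiblingStep`, `FarTreeRow`, `GluedLemmaW`, `GluedDominatedMass` OPEN; RATE class (log\*) / honest sentence of
`run/shared/lean/prim/quant/README.md` unchanged.  [this work].  Nothing here is cited as a published result.  The gluing rows served
[cite: KozmaNitzan2024, Conjecture 3 (p. 15)]; product measure [cite: Grimmett1999, §1.3 p. 10].
-/

noncomputable section

open scoped BigOperators

namespace Summit.CriticalPhenomena.PercolationContinuityZ3.Theorems
namespace Quant

open Finset

/-- the two-point law `{lo, hi; g}` (as in `…QuantLawDEC`) -/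
local notation3 "TP[" lo ", " hi ", " g ", " h "]" =>
  (g : ℝ) * (if (h : ℕ) = (hi : ℕ) then (1 : ℝ) else 0) + (1 - (g : ℝ)) * (if (h : ℕ) = (lo : ℕ) then (1 : ℝ) else 0)

/-- the cheapest admissible gate of the pair `{l, h}` at floor `x`, target `T`: `max(x, (T − 2l)/(h − l))` -/
local notation3 "CG[" x ", " T ", " l ", " h "]" => max (x : ℝ) (((T : ℝ) - 2 * ((l : ℕ) : ℝ)) / (((h : ℕ) : ℝ) - ((l : ℕ) : ℝ)))

/-- the Poisson-binomial point mass `P_G(j)`: the law of the blobs `(k, g)`, `g ∈ G`, at the atom `j·k` -/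
local notation3 "PB[" k ", " G ", " j "]" => LawDec.blobLaw (List.map (fun g : ℝ => ((k : ℕ), g)) G) ((j : ℕ) * (k : ℕ))

namespace LawDec

/-- **TEN EQUAL BLOBS AT THE POINT `g = 2 / 5`** (`s = 4`: the low atom `2k` appears only for larger `g`, while an admissible set changes exactly here):
a purely numeric instance of the uniform-spreading certificate. [this work] -/
theorem heavy_blobLaw_replicate_ten_point (k : ℕ) (hk : 0 < k) {g : ℝ} (hg : g = 2 / 5) :
    ∃ (ι : Type) (_ : Fintype ι) (lam γ : ι → ℝ) (lo hi : ι → ℕ),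
      (∀ i, 0 ≤ lam i) ∧ (∑ i, lam i = 1) ∧ (∀ i, 0 ≤ γ i ∧ γ i ≤ 1) ∧ (∀ i, lo i ≤ hi i) ∧ (∀ i, hi i ≤ 10 * k) ∧
      (∀ h, blobLaw (List.replicate 10 (k, g)) h = ∑ i, lam i * TP[lo i, hi i, γ i, h]) ∧
      (∀ i, 0 < lam i → g ≤ γ i ∧ (10 : ℝ) * k * g ≤ 2 * (lo i : ℝ) + ((hi i : ℝ) - lo i) * γ i) := by
  have hG : ∀ x ∈ List.replicate 10 g, 0 < x ∧ x < 1 := fun x hx => by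
    rw [List.eq_of_mem_replicate hx]; exact ⟨by linarith, by linarith⟩
  have hS : (List.replicate 10 g).sum = 10 * g := by
    simp only [List.replicate, List.sum_cons, List.sum_nil]; ring
  have hL : (List.replicate 10 g).length = 10 := by simp
  have hM : List.map (fun g : ℝ => (k, g)) (List.replicate 10 g) = List.replicate 10 (k, g) := by simp
  have key := heavy_blobLaw_of_unitLoad_le_one k hk (List.replicate 10 g) hG (by rw [hL]; norm_num) ?_
  · rw [hS, hL, hM] at key
    have e1 : (10 : ℝ) * g / ((10 : ℕ) : ℝ) = g := by push_cast; ring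
    have e2 : (k : ℝ) * (10 * g) = (10 : ℝ) * k * g := by ring
    rw [e1, e2] at key
    exact key
  · rw [hS, hL, hM, sum_range_11']
    push_cast
    rw [if_pos (by linarith : (2 : ℝ) * 0 < 10 * g), if_pos (by linarith : (2 : ℝ) * 1 < 10 * g), if_neg (by linarith : ¬ (2 : ℝ) * 2 < 10 * g), if_neg (by linarith : ¬ (2 : ℝ) * 3 < 10 * g), if_neg (by linarith : ¬ (2 : ℝ) * 4 < 10 * g), if_neg (by linarith : ¬ (2 : ℝ) * 5 < 10 * g), if_neg (by linarith : ¬ (2 : ℝ) * 6 < 10 * g), if_neg (by linarith : ¬ (2 : ℝ) * 7 < 10 * g), if_neg (by linarith : ¬ (2 : ℝ) * 8 < 10 * g), if_neg (by linarith : ¬ (2 : ℝ) * 9 < 10 * g), if_neg (by linarith : ¬ (2 : ℝ) * 10 < 10 * g)]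
    simp only [add_zero]
    rw [sum_range_11', sum_range_11']
    push_cast
    rw [if_neg (by linarith : ¬ (10 : ℝ) * g - 0 < 0), if_neg (by linarith : ¬ (10 : ℝ) * g - 0 < 1), if_neg (by linarith : ¬ (10 : ℝ) * g - 0 < 2), if_neg (by linarith : ¬ (10 : ℝ) * g - 0 < 3), if_neg (by linarith : ¬ (10 : ℝ) * g - 0 < 4), if_pos (by linarith : (10 : ℝ) * g - 0 < 5), if_pos (by linarith : (10 : ℝ) * g - 0 < 6), if_pos (by linarith : (10 : ℝ) * g - 0 < 7), if_pos (by linarith : (10 : ℝ) * g - 0 < 8), if_pos (by linarith : (10 : ℝ) * g - 0 < 9), if_pos (by linarith : (10 : ℝ) * g - 0 < 10), if_neg (by linarith : ¬ (10 : ℝ) * g - 1 < 0), if_neg (by linarith : ¬ (10 : ℝ) * g - 1 < 1), if_neg (by linarith : ¬ (10 : ℝ) * g - 1 < 2), if_neg (by linarith : ¬ (10 : ℝ) * g - 1 < 3), if_pos (by linarith : (10 : ℝ) * g - 1 < 4), if_pos (by linarith : (10 : ℝ) * g - 1 < 5), if_pos (by linarith : (10 : ℝ) * g - 1 < 6), if_pos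 (by linarith : (10 : ℝ) * g - 1 < 7), if_pos (by linarith : (10 : ℝ) * g - 1 < 8), if_pos (by linarith : (10 : ℝ) * g - 1 < 9), if_pos (by linarith : (10 : ℝ) * g - 1 < 10)]
    simp only [zero_add]
    rw [max_eq_right (show (10 : ℝ) * g / 10 ≤ (10 * g - 2 * 0) / (5 - 0) by rw [div_le_div_iff₀ (by norm_num) (by norm_num)]; nlinarith)]
    rw [max_eq_right (show (10 : ℝ) * g / 10 ≤ (10 * g - 2 * 0) / (6 - 0) by rw [div_le_div_iff₀ (by norm_num) (by norm_num)]; nlinarith)]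
    rw [max_eq_right (show (10 : ℝ) * g / 10 ≤ (10 * g - 2 * 0) / (7 - 0) by rw [div_le_div_iff₀ (by norm_num) (by norm_num)]; nlinarith)]
    rw [max_eq_right (show (10 : ℝ) * g / 10 ≤ (10 * g - 2 * 0) / (8 - 0) by rw [div_le_div_iff₀ (by norm_num) (by norm_num)]; nlinarith)]
    rw [max_eq_right (show (10 : ℝ) * g / 10 ≤ (10 * g - 2 * 0) / (9 - 0) by rw [div_le_div_iff₀ (by norm_num) (by norm_num)]; nlinarith)]
    rw [max_eq_right (show (10 : ℝ) * g / 10 ≤ (10 * g - 2 * 0) / (10 - 0) by rw [div_le_div_iff₀ (by norm_num) (by norm_num)]; nlinarith)]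
    rw [max_eq_right (show (10 : ℝ) * g / 10 ≤ (10 * g - 2 * 1) / (4 - 1) by rw [div_le_div_iff₀ (by norm_num) (by norm_num)]; nlinarith)]
    rw [max_eq_right (show (10 : ℝ) * g / 10 ≤ (10 * g - 2 * 1) / (5 - 1) by rw [div_le_div_iff₀ (by norm_num) (by norm_num)]; nlinarith)]
    rw [max_eq_right (show (10 : ℝ) * g / 10 ≤ (10 * g - 2 * 1) / (6 - 1) by rw [div_le_div_iff₀ (by norm_num) (by norm_num)]; nlinarith)]
    rw [max_eq_left (show ((10 : ℝ) * g - 2 * 1) / (7 - 1) ≤ 10 * g / 10 by rw [div_le_div_iff₀ (by norm_num) (by norm_num)]; nlinarith)]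
    rw [max_eq_left (show ((10 : ℝ) * g - 2 * 1) / (8 - 1) ≤ 10 * g / 10 by rw [div_le_div_iff₀ (by norm_num) (by norm_num)]; nlinarith)]
    rw [max_eq_left (show ((10 : ℝ) * g - 2 * 1) / (9 - 1) ≤ 10 * g / 10 by rw [div_le_div_iff₀ (by norm_num) (by norm_num)]; nlinarith)]
    rw [max_eq_left (show ((10 : ℝ) * g - 2 * 1) / (10 - 1) ≤ 10 * g / 10 by rw [div_le_div_iff₀ (by norm_num) (by norm_num)]; nlinarith)]
    have hb : ∀ j : ℕ, blobLaw [((k : ℕ), g), (k, g), (k, g), (k, g), (k, g), (k, g), (k, g), (k, g), (k, g), (k, g)] (j * k)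
        = (Nat.choose 10 j : ℝ) * g ^ j * (1 - g) ^ (10 - j) := fun j => blobLaw_replicate k hk g 10 j
    rw [hb 0, hb 1, hb 4, hb 5, hb 6, hb 7, hb 8, hb 9, hb 10]
    rw [show (Nat.choose 10 0 : ℝ) = 1 by norm_num [Nat.choose], show (Nat.choose 10 1 : ℝ) = 10 by norm_num [Nat.choose], show (Nat.choose 10 4 : ℝ) = 210 by norm_num [Nat.choose], show (Nat.choose 10 5 : ℝ) = 252 by norm_num [Nat.choose], show (Nat.choose 10 6 : ℝ) = 210 by norm_num [Nat.choose], show (Nat.choose 10 7 : ℝ) = 120 by norm_num [Nat.choose], show (Nat.choose 10 8 : ℝ) = 45 by norm_num [Nat.choose], show (Nat.choose 10 9 : ℝ) = 10 by norm_num [Nat.choose], show (Nat.choose 10 10 : ℝ) = 1 by norm_num [Nat.choose]]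
    subst hg
    norm_num

/-- **TEN EQUAL BLOBS WITH A COMMON GATE `g ∈ (0,1)` ARE HEAVY AT FLOOR `g`, TARGET `10·k·g` — EVERY `g`, EVERY `k ≥ 1`** (conjecture BLOB-AFL at width 10, equal gates). [this work] -/
theorem heavy_blobLaw_replicate_ten (k : ℕ) (hk : 0 < k) {g : ℝ} (hg0 : 0 < g) (hg1 : g < 1) :
    ∃ (ι : Type) (_ : Fintype ι) (lam γ : ι → ℝ) (lo hi : ι → ℕ),
      (∀ i, 0 ≤ lam i) ∧ (∑ i, lam i = 1) ∧ (∀ i, 0 ≤ γ i ∧ γ i ≤ 1) ∧ (∀ i, lo i ≤ hi i) ∧ (∀ i, hi i ≤ 10 * k) ∧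
      (∀ h, blobLaw (List.replicate 10 (k, g)) h = ∑ i, lam i * TP[lo i, hi i, γ i, h]) ∧
      (∀ i, 0 < lam i → g ≤ γ i ∧ (10 : ℝ) * k * g ≤ 2 * (lo i : ℝ) + ((hi i : ℝ) - lo i) * γ i) := by
  have hk' : (0 : ℝ) < k := by exact_mod_cast hk
  rcases le_or_gt g (1 / 5) with hle | hlt
  · have hl : ∀ p ∈ List.replicate 10 (k, g), p.1 = k ∧ 0 ≤ p.2 ∧ p.2 ≤ 1 := fun p hp => by
      rw [List.eq_of_mem_replicate hp]; exact ⟨rfl, hg0.le, hg1.le⟩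
    have htop : blobTop (List.replicate 10 (k, g)) = 10 * k := blobTop_replicate 10 k g
    have hmean : blobMean (List.replicate 10 (k, g)) = (10 : ℝ) * k * g := by
      rw [blobMean_replicate]; push_cast; ring
    have hm0 : 0 < blobMean (List.replicate 10 (k, g)) := by rw [hmean]; positivity
    have hm2 : blobMean (List.replicate 10 (k, g)) ≤ 2 * k := by rw [hmean]; nlinarith
    have key := heavy_blobLaw_of_mean_le_two k _ hl hm0 hm2
    rw [hmean, htop] at key
    have e : (10 : ℝ) * k * g / ((10 * k : ℕ) : ℝ) = g := by push_cast; field_simp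
    rw [e] at key
    exact key
  · rcases lt_or_ge g (2 / 9) with hc0 | hge0
    · exact heavy_blobLaw_replicate_ten_cell0 k hk hlt hc0
    · rcases lt_or_ge g (1 / 4) with hc1 | hge1
      · exact heavy_blobLaw_replicate_ten_cell1 k hk hge0 hc1
      · rcases lt_or_ge g (2 / 7) with hc2 | hge2
        · exact heavy_blobLaw_replicate_ten_cell2 k hk hge1 hc2
        · rcases lt_or_ge g (3 / 10) with hc3 | hge3
          · exact heavy_blobLaw_replicate_ten_cell3 k hk hge2 hc3
          · rcases lt_or_ge g (1 / 3) with hc4 | hge4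
            · exact heavy_blobLaw_replicate_ten_cell4 k hk hge3 hc4
            · rcases lt_or_ge g (2 / 5) with hc5 | hge5
              · exact heavy_blobLaw_replicate_ten_cell5 k hk hge4 hc5
              · rcases hge5.eq_or_lt with heq | hgt5
                · exact heavy_blobLaw_replicate_ten_point k hk heq.symm
                rcases lt_or_ge g (4 / 9) with hc6 | hge6
                · exact heavy_blobLaw_replicate_ten_cell6 k hk hgt5 hc6
                · rcases lt_or_ge g (1 / 2) with hc7 | hge7
                  · exact heavy_blobLaw_replicate_ten_cell7 k hk hge6 hc7
                  · have hge := hge7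
                    have key := heavy_blobLaw_replicate_of_half_le 10 k hge hg1
                    push_cast at key
                    exact key

/-- **hence DEC at every layer** for 10 equal blobs with any common gate `g ∈ (0,1)`. [this work] -/
theorem decAtT_blobLaw_replicate_ten (k : ℕ) (hk : 0 < k) {g : ℝ} (hg0 : 0 < g) (hg1 : g < 1) (j : ℕ) :
    DECAtT g ((10 : ℝ) * k * g) j (10 * k) (blobLaw (List.replicate 10 (k, g))) :=
  decAtT_of_heavy _ _ _ _ (heavy_blobLaw_replicate_ten k hk hg0 hg1) j

end LawDec
end Quant
end Summit.CriticalPhenomena.PercolationContinuityZ3.Theorems
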